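import Summits.RiemannHypothesis.RiemannHypothesis.Theorems.TiltedLandingLaw421R3Bot

/-! # TiltedLandingLaw421R3QuadW
SUPPORT module for crux `TiltedLandingLaw421` (stmt-RiemannHypothesis-24774), `--supports … --as helper` only: proves no stub, no crux; fully proved (no `sorry`).
W-08 ROUND-3b (director (CA334) option (Q) / (CA335) rule: BAND-quadratic (Markov) tracking window `(max (|u.re − x₀| − R/2) 0)² + j·(u.im)² ≤ j·Hs²` (aperture R/2; level 0 = `StCol' 0` verbatim) as conjunct 4 of `RhW08.QuadW.StColQ'`, replacing the linear column clause `|u.re − x₀| ≤ R/2 + j·(s/4)` of `StCol'` (C6 ADD-86 frame A / ADD-92 frame C; (CA333) HOLD); node `RhW08.SealSwapQ.law421T_of_alphaFreeQ`, stub texts `RhW08.SealSwapQ.RestSuccBotQ`/`RestRateBotQ`, composition `law421T_of_succ_rateQ`, INIT♯^Q from INIT♯ by `restInitBotQ_of_restInitBot` (typing-robust, rev d), NO α stub; tracked-class typing (iv) BAND MEMBERSHIP `StTrkDQ := StColQ'` (C1 WORDS-60/60b/61 part-1 image `splitQ1-R3QuadW-band-W08-C1-rh-idea-5-g24.lean`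 0a4973de over C4 rev d parts 2/3; `band_step'`/`band_of_quad'`/`band_of_hull'` proved: BAND ⊇ Q, BAND ⊇ HULL); part-1 typing keyed by director g21 on the bus per the (CA335) rule (see the tenure CERT); parts 2/3 byte-identical under every part-1 typing)
cut by tenure rh-tenure-earlyapp-1 g7 from the single rc-0 base `monolithK29-band-W08-C1-rh-idea-5-g24.lean` sha256 d9d5cc26bdbc420bb637c77656e7eaed80199db59ff477a17aa0c34a6c080e5c (C1 g24 WORDS-61 (band) over C4 g26 §K.29 rev d base monolithK29-band-W08-C1-rh-idea-5-g24.lean d9d5cc26bdbc420b): decl blocks byte-verbatim, base order, dependency closure of the roots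
{StColQ', NestedStep, StTrkDQ, EmptyTrkDQ, abs_sub_le_add_rho, rho_nonneg, rho_le_rho_add_abs, abs_re_sub_le_mul_of_stColQ', levelFinite_stColQ', upperStates_stColQ', stColQ'_zero_iff_stCol'_zero, stColQ'_zero_of_root, subPred_stTrkDQ, levelFinite_stTrkDQ, upperStates_stTrkDQ, stTrkDQ_zero_iff, stTrkDQ_zero_iff_stCol'_zero, stTrkDQ_zero_of_stTrkD_zero, init0Sig_stTrkDQ, quad_step', band_step', band_of_hang, quad_of_hang, band_of_quad', band_of_hull', quad_of_stTrkDQ, abs_re_sub_le_of_stTrkDQ, radius_lt_range', band_radius_lt_range'} minus every declaration already LANDED in the W-08 tree chain (#986 R2StSwap · #988 R2Ready · #991 R2TrkD · #994 R2NodeD · #998 R2NodeDR · #999 R2CoreP · #1000 R2FlatM · #1007 R3Forms · #1008 R3Bot).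
K = kernel-checked lemmas about MODEL sockets (combs / polynomials), not ζ/Ξ. Typed ≠ proved; RH is not proved; 24774 OPEN. -/

namespace RhW08.QuadW

open Complex Set
open RhIdea6.G17.W07C7 RhIdea6.G17.W07C7.Rev6 RhIdea6.G18.W07C8.Law421BirthS RhIdea6.G19.W07C11.Seam
open RhIdea6.G20.W07C12.Frac RhIdea6.G20.W07C12.StColP RhW07.C12.FieldSplit RhIdea6.G21.W07C13.TentMax
open RhW07.C14.TwoSided RhW07.C14.Classes RhW07.C14.Lineage RhW07.C14.Booking
open RhW07.C13.Heredity RhIdea6.G22.W07C15pre.Injection RhW07.E3.Cell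
open RhW07.E3.Lit
open RhW08.Round1 RhW08.StSwap RhW08.Round2

section States

/-- ★ §Q.1-BAND **`StColQ'`** — the level-`j` non-real zeros of `f⁽ʲ⁾` in the BAND-QUADRATIC window: `StCol'` (Seam09) with its 4th conjunct
`|u.re − x₀| ≤ R/2 + j·(s/4)` replaced by `(max (|u.re − x₀| − R/2) 0)² + j·u.im² ≤ j·Hs²` (C1 WORDS-60; aperture `R/2`). -/
def StColQ' : StatePred := fun _η f x₀ _s _hmax R Hs _B j u =>
  iteratedDeriv j f ≠ 0 ∧ iteratedDeriv j f u = 0 ∧ 0 < u.im ∧ (max (|u.re - x₀| - R / 2) 0) ^ 2 + (j : ℝ) * u.im ^ 2 ≤ (j : ℝ) * Hs ^ 2 ∧ u.im ≤ Hs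

/-- §Q.1 the JENSEN-NESTED step: the child lies in the parent's closed Jensen disc (a LEMMA-side notion; not part of the class). -/
def NestedStep (v w : ℂ) : Prop := (w.re - v.re) ^ 2 + w.im ^ 2 ≤ v.im ^ 2

/-- ★★ §Q.1-BAND **`StTrkDQ`** — TYPING «WINDOW-ONLY / MEMBERSHIP»: the tracked class IS the band-window class. -/
def StTrkDQ : StatePred := StColQ'

/-- §Q.1 the level class «tracked band-level empty» (booked-root meter weight 3/2). -/
def EmptyTrkDQ : LevelClass := EmptyClassG StTrkDQ (3 / 2)

/-- (K) the band distance is below the distance to the column minus nothing: `|t − x₀| ≤ R/2 + ρ`. -/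
theorem abs_sub_le_add_rho (x₀ R t : ℝ) : |t - x₀| ≤ R / 2 + max (|t - x₀| - R / 2) 0 := by
  have := le_max_left (|t - x₀| - R / 2) 0
  linarith

/-- (K) ρ ≥ 0. -/
theorem rho_nonneg (x₀ R t : ℝ) : 0 ≤ max (|t - x₀| - R / 2) 0 := le_max_right _ _

/-- (K) ρ is 1-Lipschitz in the abscissa. -/
theorem rho_le_rho_add_abs (x₀ R t t' : ℝ) : max (|t' - x₀| - R / 2) 0 ≤ max (|t - x₀| - R / 2) 0 + |t' - t| := by
  have h1 : |t' - x₀| ≤ |t - x₀| + |t' - t| := by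
    have := abs_sub_le t' t x₀
    linarith [abs_sub_comm t' t]
  rcases le_total (|t - x₀| - R / 2) 0 with h | h
  · rw [max_eq_right h]
    exact max_le (by linarith) (by linarith [abs_nonneg (t' - t)])
  · rw [max_eq_left h]
    exact max_le (by linarith) (by linarith [abs_nonneg (t' - t)])

/-- (K) a band state's horizontal offset is at most `R/2 + j·Hs` (crude: `ρ² ≤ j·Hs² ≤ (j·Hs)²` for `j ≥ 1`, `ρ = 0` for `j = 0`). -/
theorem abs_re_sub_le_mul_of_stColQ' {η : ℝ} {f : ℂ → ℂ} {x₀ s hmax R Hs : ℝ} {B j : ℕ} {u : ℂ} (hHs : 0 ≤ Hs)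
    (hu : StColQ' η f x₀ s hmax R Hs B j u) : |u.re - x₀| ≤ R / 2 + (j : ℝ) * Hs := by
  obtain ⟨-, -, him, hq, -⟩ := hu
  have hj : (0 : ℝ) ≤ (j : ℝ) := Nat.cast_nonneg j
  have h1 : (max (|u.re - x₀| - R / 2) 0) ^ 2 ≤ (j : ℝ) * Hs ^ 2 := by nlinarith [sq_nonneg u.im]
  have h2 : (j : ℝ) * Hs ^ 2 ≤ ((j : ℝ) * Hs) ^ 2 := by
    rcases Nat.eq_zero_or_pos j with h0 | hpos
    · subst h0; simp
    · have hj1 : (1 : ℝ) ≤ (j : ℝ) := by exact_mod_cast hpos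
      nlinarith [sq_nonneg Hs]
  have h3 : max (|u.re - x₀| - R / 2) 0 ≤ (j : ℝ) * Hs := abs_le_of_sq_le_sq (by linarith) (mul_nonneg hj hHs) |>.trans' (le_abs_self _)
  linarith [abs_sub_le_add_rho x₀ R u.re]

/-- (K) §Q.1 the band levels are FINITE on engine data (zeros of the non-zero entire `f⁽ʲ⁾` in a bounded box). -/
theorem levelFinite_stColQ' : LevelFinite StColQ' := by
  intro η f x₀ s hmax R Hs B hE j
  have hdiff : Differentiable ℂ f := hE.1
  have hHs : 0 ≤ Hs := hE.2.2.2.2.2.2.2.1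
  by_cases hg : iteratedDeriv j f = 0
  · have : {w : ℂ | StColQ' η f x₀ s hmax R Hs B j w} = ∅ := by
      ext w
      simp only [Set.mem_setOf_eq, Set.mem_empty_iff_false, iff_false]
      exact fun hw => hw.1 hg
    rw [this]; exact Set.finite_empty
  · have hgd : Differentiable ℂ (iteratedDeriv j f) := Literature.Analysis.Complex.differentiable_iteratedDeriv_of_entire hdiff j
    refine (finite_zeros_closedBall_of_entire hgd hg (x₀ : ℂ) (|R| / 2 + (j : ℝ) * Hs + Hs)).subset ?_
    intro w hw
    have hwre : |w.re - x₀| ≤ R / 2 + (j : ℝ) * Hs := abs_re_sub_le_mul_of_stColQ' (η := η) (s := s) (hmax := hmax) (B := B) hHs hw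
    obtain ⟨-, hw0, hwim, -, hwHs⟩ := hw
    refine ⟨?_, hw0⟩
    rw [Metric.mem_closedBall, dist_eq_norm]
    have h1 : ‖w - (x₀ : ℂ)‖ ≤ |(w - (x₀ : ℂ)).re| + |(w - (x₀ : ℂ)).im| := Complex.norm_le_abs_re_add_abs_im _
    have h2 : (w - (x₀ : ℂ)).re = w.re - x₀ := by simp
    have h3 : (w - (x₀ : ℂ)).im = w.im := by simp
    rw [h2, h3, abs_of_pos hwim] at h1
    have h4 : R / 2 ≤ |R| / 2 := by linarith [le_abs_self R]
    linarith

/-- (K) §Q.1 band states lie in the open upper half-plane. -/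
theorem upperStates_stColQ' : UpperStates StColQ' := fun _ _ _ _ _ _ _ _ _ _ h => h.2.2.1

/-- ★ (K) §Q.1-BAND LEVEL 0 OF THE BAND FAMILY IS `StCol' 0` (the round-3 level-0 class): `ρ² + 0 ≤ 0 ⟺ |u.re − x₀| ≤ R/2 + 0·(s/4)`. -/
theorem stColQ'_zero_iff_stCol'_zero (η : ℝ) (f : ℂ → ℂ) (x₀ s hmax R Hs : ℝ) (B : ℕ) (u : ℂ) :
    StColQ' η f x₀ s hmax R Hs B 0 u ↔ StCol' η f x₀ s hmax R Hs B 0 u := by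
  constructor
  · rintro ⟨hne, hz, him, hq, hHs⟩
    refine ⟨hne, hz, him, ?_, hHs⟩
    have h1 : (max (|u.re - x₀| - R / 2) 0) ^ 2 ≤ 0 := by simpa using hq
    have h2 : max (|u.re - x₀| - R / 2) 0 = 0 := pow_eq_zero_iff (two_ne_zero) |>.mp (le_antisymm h1 (sq_nonneg _))
    have h3 := le_max_left (|u.re - x₀| - R / 2) 0
    rw [h2] at h3
    push_cast
    linarith
  · rintro ⟨hne, hz, him, hw, hHs⟩
    refine ⟨hne, hz, him, ?_, hHs⟩
    have hw' : |u.re - x₀| ≤ R / 2 := by simpa using hw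
    have h2 : max (|u.re - x₀| - R / 2) 0 = 0 := max_eq_right (by linarith)
    rw [h2]; simp

/-- (K) §Q.1 a root-column state is a level-0 band state (interface name kept from the sibling images; `hre` is not needed in the band). -/
theorem stColQ'_zero_of_root {η : ℝ} {f : ℂ → ℂ} {x₀ s hmax R Hs : ℝ} {B : ℕ} {u : ℂ}
    (h0 : StCol' η f x₀ s hmax R Hs B 0 u) (_hre : u.re = x₀) : StColQ' η f x₀ s hmax R Hs B 0 u :=
  (stColQ'_zero_iff_stCol'_zero η f x₀ s hmax R Hs B u).mpr h0

/-- (K) §Q.1 tracked band states are band states (by definition). -/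
theorem subPred_stTrkDQ : SubPred StTrkDQ StColQ' := fun _ _ _ _ _ _ _ _ _ _ hu => hu

/-- (K) §Q.1 instance: finite tracked band levels. -/
theorem levelFinite_stTrkDQ : LevelFinite StTrkDQ := levelFinite_of_subPred subPred_stTrkDQ levelFinite_stColQ'

/-- (K) §Q.1 instance: tracked band states are in the upper half-plane. -/
theorem upperStates_stTrkDQ : UpperStates StTrkDQ := upperStates_of_subPred subPred_stTrkDQ upperStates_stColQ'

/-- (K) §Q.1 level 0 of the band family = the level-0 band states. -/
theorem stTrkDQ_zero_iff (η : ℝ) (f : ℂ → ℂ) (x₀ s hmax R Hs : ℝ) (B : ℕ) (u : ℂ) :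
    StTrkDQ η f x₀ s hmax R Hs B 0 u ↔ StColQ' η f x₀ s hmax R Hs B 0 u := Iff.rfl

/-- ★ (K) §Q.1-BAND level 0 of the band family = `StCol' 0` (ALL level-0 window states, as in round 3's `StTrkD 0 ⊆ StCol' 0`). -/
theorem stTrkDQ_zero_iff_stCol'_zero (η : ℝ) (f : ℂ → ℂ) (x₀ s hmax R Hs : ℝ) (B : ℕ) (u : ℂ) :
    StTrkDQ η f x₀ s hmax R Hs B 0 u ↔ StCol' η f x₀ s hmax R Hs B 0 u := stColQ'_zero_iff_stCol'_zero η f x₀ s hmax R Hs B u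

/-- (K) §Q.1 the root-column states (`StTrkD`'s level 0) are level-0 states of the band family (the INTERFACE lemma parts 2/3 consume). -/
theorem stTrkDQ_zero_of_stTrkD_zero {η : ℝ} {f : ℂ → ℂ} {x₀ s hmax R Hs : ℝ} {B : ℕ} {u : ℂ} (h : StTrkD η f x₀ s hmax R Hs B 0 u) :
    StTrkDQ η f x₀ s hmax R Hs B 0 u := by
  obtain ⟨h0, hre⟩ := (chainOf_zero_iff TrkStepD η f x₀ s hmax R Hs B u).mp h
  exact stColQ'_zero_of_root h0 hre

/-- (K) §Q.1 instance: the SEED (the engine's `w₀`, reflected up) is a level-0 state of the band family of height `≤ hmax`. -/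
theorem init0Sig_stTrkDQ : Init0Sig StTrkDQ := by
  intro η f x₀ s hmax R Hs B hE
  obtain ⟨u, hu, huh⟩ := init0Sig_chainOf TrkStepD η f x₀ s hmax R Hs B hE
  exact ⟨u, stTrkDQ_zero_of_stTrkD_zero hu, huh⟩

/-- ★ (K) §Q.1 **THE QUADRATIC MARKOV STEP** (C1 `RhW08.QuadWindow.quad_step`; C4 `quad_step'`), abstract form over reals:
`x² + j·b² ≤ j·H²`, `b² ≤ H²`, `δ² + b'² ≤ b²` ⇒ `(x+δ)² + (j+1)·b'² ≤ (j+1)·H²`. -/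
theorem quad_step' {x b δ b' H : ℝ} {j : ℕ} (hQ : x ^ 2 + (j : ℝ) * b ^ 2 ≤ (j : ℝ) * H ^ 2) (hb : b ^ 2 ≤ H ^ 2)
    (hnest : δ ^ 2 + b' ^ 2 ≤ b ^ 2) :
    (x + δ) ^ 2 + ((j : ℝ) + 1) * b' ^ 2 ≤ ((j : ℝ) + 1) * H ^ 2 := by
  have hj : (0 : ℝ) ≤ j := Nat.cast_nonneg j
  have hA : 0 ≤ H ^ 2 - b ^ 2 := by linarith
  have hB : δ ^ 2 ≤ b ^ 2 - b' ^ 2 := by linarith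
  have hx : x ^ 2 ≤ (j : ℝ) * (H ^ 2 - b ^ 2) := by nlinarith
  have hprod : (2 * x * δ) ^ 2 ≤ ((H ^ 2 - b ^ 2) + (j : ℝ) * (b ^ 2 - b' ^ 2)) ^ 2 := by
    have h5 : 4 * x ^ 2 * δ ^ 2 ≤ 4 * ((j : ℝ) * (H ^ 2 - b ^ 2)) * (b ^ 2 - b' ^ 2) := by
      have := mul_le_mul hx hB (sq_nonneg δ) (mul_nonneg hj hA)
      nlinarith
    nlinarith [sq_nonneg ((H ^ 2 - b ^ 2) - (j : ℝ) * (b ^ 2 - b' ^ 2))]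
  have hsum : 0 ≤ (H ^ 2 - b ^ 2) + (j : ℝ) * (b ^ 2 - b' ^ 2) := by
    have : 0 ≤ b ^ 2 - b' ^ 2 := le_trans (sq_nonneg δ) hB
    positivity
  have h2xd : 2 * x * δ ≤ (H ^ 2 - b ^ 2) + (j : ℝ) * (b ^ 2 - b' ^ 2) := (abs_le_of_sq_le_sq' hprod hsum).2
  nlinarith

/-- ★★ (K) §Q.1-BAND **THE BAND MARKOV STEP**: `QB_j(v)`, `Im v² ≤ Hs²`, `NestedStep v w` ⇒ `QB_{j+1}(w)` (ρ is 1-Lipschitz, then `quad_step'` with `|δ|`). -/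
theorem band_step' {x₀ R Hs : ℝ} {j : ℕ} {v w : ℂ}
    (hq : (max (|v.re - x₀| - R / 2) 0) ^ 2 + (j : ℝ) * v.im ^ 2 ≤ (j : ℝ) * Hs ^ 2) (hvHs : v.im ^ 2 ≤ Hs ^ 2) (hn : NestedStep v w) :
    (max (|w.re - x₀| - R / 2) 0) ^ 2 + ((j : ℝ) + 1) * w.im ^ 2 ≤ ((j : ℝ) + 1) * Hs ^ 2 := by
  unfold NestedStep at hn
  have hn' : |w.re - v.re| ^ 2 + w.im ^ 2 ≤ v.im ^ 2 := by rwa [sq_abs]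
  have hstep := quad_step' (x := max (|v.re - x₀| - R / 2) 0) (δ := |w.re - v.re|) hq hvHs hn'
  have hlip : max (|w.re - x₀| - R / 2) 0 ≤ max (|v.re - x₀| - R / 2) 0 + |w.re - v.re| := rho_le_rho_add_abs x₀ R v.re w.re
  have hsq : (max (|w.re - x₀| - R / 2) 0) ^ 2 ≤ (max (|v.re - x₀| - R / 2) 0 + |w.re - v.re|) ^ 2 :=
    pow_le_pow_left₀ (rho_nonneg x₀ R w.re) hlip 2
  linarith

/-- ★ (K) §Q.1-BAND HANGING DISCHARGES THE WINDOW: a next-level point in the closed Jensen disc of ANY band state is in the next band window. -/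
theorem band_of_hang {η : ℝ} {f : ℂ → ℂ} {x₀ s hmax R Hs : ℝ} {B j : ℕ} {v w : ℂ} (hv : StColQ' η f x₀ s hmax R Hs B j v) (hn : NestedStep v w) :
    (max (|w.re - x₀| - R / 2) 0) ^ 2 + ((j : ℝ) + 1) * w.im ^ 2 ≤ ((j : ℝ) + 1) * Hs ^ 2 := by
  have hvHs : v.im ^ 2 ≤ Hs ^ 2 := by
    have h1 : 0 < v.im := hv.2.2.1
    have h2 : v.im ≤ Hs := hv.2.2.2.2
    nlinarith
  exact band_step' hv.2.2.2.1 hvHs hn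

/-- (K) alias under the sibling images' name (parts 2/3 docstrings cite it): hanging discharges the window. -/
theorem quad_of_hang {η : ℝ} {f : ℂ → ℂ} {x₀ s hmax R Hs : ℝ} {B j : ℕ} {v w : ℂ} (hv : StColQ' η f x₀ s hmax R Hs B j v) (hn : NestedStep v w) :
    (max (|w.re - x₀| - R / 2) 0) ^ 2 + ((j : ℝ) + 1) * w.im ^ 2 ≤ ((j : ℝ) + 1) * Hs ^ 2 := band_of_hang hv hn

/-- ★ (K) §Q.1-BAND `Q ⊆ BAND`: the pure quadratic window implies the band window whenever `0 ≤ R`. -/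
theorem band_of_quad' {x₀ R Hs t b : ℝ} {j : ℕ} (hR : 0 ≤ R) (hQ : (t - x₀) ^ 2 + (j : ℝ) * b ^ 2 ≤ (j : ℝ) * Hs ^ 2) :
    (max (|t - x₀| - R / 2) 0) ^ 2 + (j : ℝ) * b ^ 2 ≤ (j : ℝ) * Hs ^ 2 := by
  have hle : max (|t - x₀| - R / 2) 0 ≤ |t - x₀| := max_le (by linarith) (abs_nonneg _)
  have hsq : (max (|t - x₀| - R / 2) 0) ^ 2 ≤ (t - x₀) ^ 2 := by
    rw [← sq_abs (t - x₀)]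
    exact pow_le_pow_left₀ (rho_nonneg x₀ R t) hle 2
  linarith

/-- ★ (K) §Q.1-BAND `HULL ⊆ BAND`: the level-`j` Jensen-chain hull disc of a level-0 pair inside the aperture lies in the band window (director (CA335)'s
cluster window is a STRONGER membership demand than the band). -/
theorem band_of_hull' {x₀ R Hs v₀re v₀im t b : ℝ} {j : ℕ} (hv₀ : |v₀re - x₀| ≤ R / 2) (hH : v₀im ^ 2 ≤ Hs ^ 2)
    (hhull : (t - v₀re) ^ 2 + (j : ℝ) * b ^ 2 ≤ (j : ℝ) * v₀im ^ 2) :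
    (max (|t - x₀| - R / 2) 0) ^ 2 + (j : ℝ) * b ^ 2 ≤ (j : ℝ) * Hs ^ 2 := by
  have hj : (0 : ℝ) ≤ j := Nat.cast_nonneg j
  have h0 : max (|v₀re - x₀| - R / 2) 0 = 0 := max_eq_right (by linarith)
  have hlip : max (|t - x₀| - R / 2) 0 ≤ |t - v₀re| := by
    have := rho_le_rho_add_abs x₀ R v₀re t
    rw [h0, zero_add] at this
    exact this
  have hsq : (max (|t - x₀| - R / 2) 0) ^ 2 ≤ (t - v₀re) ^ 2 := by
    rw [← sq_abs (t - v₀re)]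
    exact pow_le_pow_left₀ (rho_nonneg x₀ R t) hlip 2
  nlinarith [mul_le_mul_of_nonneg_left hH hj]

/-- (K) §Q.1 `QB_j` holds along the tracked class (it is a conjunct of `StColQ' j`). -/
theorem quad_of_stTrkDQ {η : ℝ} {f : ℂ → ℂ} {x₀ s hmax R Hs : ℝ} {B j : ℕ} {u : ℂ} (hu : StTrkDQ η f x₀ s hmax R Hs B j u) :
    (max (|u.re - x₀| - R / 2) 0) ^ 2 + (j : ℝ) * u.im ^ 2 ≤ (j : ℝ) * Hs ^ 2 :=
  (subPred_stTrkDQ η f x₀ s hmax R Hs B j u hu).2.2.2.1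

/-- ★ (K) §Q.1-BAND the TRACKED RADIUS: `|u.re − x₀| ≤ R/2 + √j · Hs` along the band class. -/
theorem abs_re_sub_le_of_stTrkDQ {η : ℝ} {f : ℂ → ℂ} {x₀ s hmax R Hs : ℝ} {B j : ℕ} {u : ℂ} (hHs : 0 ≤ Hs)
    (hu : StTrkDQ η f x₀ s hmax R Hs B j u) : |u.re - x₀| ≤ R / 2 + Real.sqrt j * Hs := by
  have hq := quad_of_stTrkDQ hu
  have h1 : (max (|u.re - x₀| - R / 2) 0) ^ 2 ≤ (j : ℝ) * Hs ^ 2 := by nlinarith [sq_nonneg u.im, Nat.cast_nonneg (α := ℝ) j]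
  have h2 : (Real.sqrt j * Hs) ^ 2 = (j : ℝ) * Hs ^ 2 := by
    rw [mul_pow, Real.sq_sqrt (Nat.cast_nonneg j)]
  have h3 : max (|u.re - x₀| - R / 2) 0 ≤ Real.sqrt j * Hs :=
    (abs_le_of_sq_le_sq (by rw [h2]; exact h1) (mul_nonneg (Real.sqrt_nonneg _) hHs)).trans' (le_abs_self _)
  linarith [abs_sub_le_add_rho x₀ R u.re]

/-- (K) §Q.1 `√j·Hs + Hs < (j+3)·R/2` (sibling images' lemma, kept). -/
theorem radius_lt_range' {R Hs : ℝ} (hHs : 0 ≤ Hs) (hR : 2 * Hs ≤ R) (hR0 : 0 < R) (j : ℕ) :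
    Real.sqrt j * Hs + Hs < ((j : ℝ) + 3) * R / 2 := by
  have hj : (0 : ℝ) ≤ (j : ℝ) := Nat.cast_nonneg j
  have hs : Real.sqrt j ≤ ((j : ℝ) + 1) / 2 := by
    rw [Real.sqrt_le_left (by linarith)]
    nlinarith [sq_nonneg ((j : ℝ) - 1)]
  have h1 : Real.sqrt j * Hs ≤ ((j : ℝ) + 1) / 2 * Hs := mul_le_mul_of_nonneg_right hs hHs
  nlinarith

/-- ★ (K) §Q.1-BAND **BAND RADIUS < RANGE**: `R/2 + √j·Hs + Hs < (j+3)·R/2` whenever `0 ≤ Hs`, `2·Hs ≤ R`, `0 < R` — a band state together with its Jensen disc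
lies inside the LAW's `TiltReady` range `|x − x₀| < (j+3)R/2` at every level. -/
theorem band_radius_lt_range' {R Hs : ℝ} (hHs : 0 ≤ Hs) (hR : 2 * Hs ≤ R) (hR0 : 0 < R) (j : ℕ) :
    R / 2 + Real.sqrt j * Hs + Hs < ((j : ℝ) + 3) * R / 2 := by
  have hj : (0 : ℝ) ≤ (j : ℝ) := Nat.cast_nonneg j
  have hs : Real.sqrt j ≤ ((j : ℝ) + 1) / 2 := by
    rw [Real.sqrt_le_left (by linarith)]
    nlinarith [sq_nonneg ((j : ℝ) - 1)]
  have h1 : Real.sqrt j * Hs ≤ ((j : ℝ) + 1) / 2 * Hs := mul_le_mul_of_nonneg_right hs hHs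
  nlinarith
end States

end RhW08.QuadW
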